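import Summits.Ventures.PercRepro.RLSRuleOneLineGeom
import Summits.Ventures.PercRepro.RLSZeroWorld

/-!
# PercRepro — planes with exactly one `3`-point line at `t = 0`: the witness counts (night-3, gen 3)

The three loss accountings of `proofs/N3-R3PLUS-plan.md` §1 (ii) for a rank-`3` subset `B′ ⊇ ℓ` of a `OneLine`
plane, as counts over the witness family of an independent `K ⊆ E ∖ G` with `|K| = p = n + 4`, against the (unique)
coplanar triple `C ⊆ K` along `ℓ`:

* `sum_filter_subset_witnessFamily`: `Σ_{X ∈ W, C ⊆ X} g |X| = Σ_{j < n − 2} C(n + 1, j) · g (j + 3)` — the lost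
  witnesses at level `x` are the `C(p − 3, x − 3)` supersets of `C`;
* `sum_good_four_ge`: `Σ_{X ∈ W, C ⊄ X} 3 / C(4 + |X|, 3) ≥ 3 (z₁ − lost₄) ≥ Φ(p, 3)` (`U0.zero_l3four`);
* `sum_good_five_ge`: `Σ_{X ∈ W, C ⊄ X} 8 / C(5 + |X|, 3) ≥ 8 (z₂ − lost₅) ≥ Φ(p, 3)` (`U0.zero_l3five`);
* `card_not_subset_ge`: `#{X ∈ W : C ⊄ X} ≥ l2aSum n = Σ_x C(p − 3, x) + 3 C(p − 3, x − 1) ≥ Φ(p, 3)`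
  (`U0.zero_l2a`: the witnesses with at most one point of `C`).
Imports `RLSRuleOneLineGeom`, `RLSZeroWorld`.  Axioms: standard.
-/

open scoped Matroid

namespace PercRepro

namespace NightThree

open Finset ThmH PerFlat

variable {α : Type*} [DecidableEq α]

/-- The supersets of a fixed `3`-subset `C` in the witness family, weighted by a function of the size. -/
theorem sum_filter_subset_witnessFamily {K C : Finset α} {n : ℕ} (hn : 2 ≤ n) (hK : K.card = n + 4) (hC : C ⊆ K)
    (hCc : C.card = 3) (g : ℕ → ℚ) :
    ∑ X ∈ (witnessFamily K n).filter (fun X => C ⊆ X), g X.card =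
      ∑ j ∈ range (n - 2), ((n + 1).choose j : ℚ) * g (j + 3) := by
  classical
  unfold witnessFamily
  rw [Finset.filter_biUnion, Finset.sum_biUnion]
  · have hinner : ∀ x ∈ Finset.Ico 1 (n + 1),
        ∑ X ∈ (K.powersetCard x).filter (fun X => C ⊆ X), g X.card =
          if 3 ≤ x then ((n + 1).choose (x - 3) : ℚ) * g x else 0 := by
      intro x _
      rw [Finset.sum_congr rfl (fun X hX => by
        rw [(Finset.mem_powersetCard.1 (Finset.mem_filter.1 hX).1).2]), Finset.sum_const, nsmul_eq_mul]
      by_cases h3 : 3 ≤ x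
      · rw [if_pos h3, card_filter_subset_powersetCard hC hCc h3, hK, show n + 4 - 3 = n + 1 by omega]
      · rw [if_neg h3]
        have : ((K.powersetCard x).filter (fun X => C ⊆ X)) = ∅ := by
          rw [Finset.eq_empty_iff_forall_notMem]
          intro X hX
          rw [Finset.mem_filter, Finset.mem_powersetCard] at hX
          have := Finset.card_le_card hX.2
          omega
        rw [this, Finset.card_empty, Nat.cast_zero, zero_mul]
    rw [Finset.sum_congr rfl hinner]
    rw [← Finset.sum_Ico_consecutive _ (show 1 ≤ 3 by norm_num) (show 3 ≤ n + 1 by omega)]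
    have hz : ∑ x ∈ Finset.Ico 1 3, (if 3 ≤ x then ((n + 1).choose (x - 3) : ℚ) * g x else 0) = 0 := by
      apply Finset.sum_eq_zero
      intro x hx
      rw [Finset.mem_Ico] at hx
      rw [if_neg (by omega)]
    rw [hz, zero_add, Finset.sum_Ico_eq_sum_range, show n + 1 - 3 = n - 2 by omega]
    apply Finset.sum_congr rfl
    intro j _
    rw [if_pos (by omega), show 3 + j - 3 = j by omega, add_comm 3 j]
  · exact (K.pairwise_disjoint_powersetCard.set_pairwise _).mono' (fun x y h => by
      exact Finset.disjoint_filter_filter h)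

/-- The good witnesses of a `4`-set `B′ ⊇ ℓ` pay at least `Φ(p, 3)`: `Σ_{C ⊄ X} 3 / C(4 + |X|, 3) ≥ Φ`. -/
theorem sum_good_four_ge {K C : Finset α} {n : ℕ} (hn : 4 ≤ n) (hK : K.card = n + 4) (hC : C ⊆ K)
    (hCc : C.card = 3) :
    phiK (n + 4) 3 ≤ ∑ X ∈ (witnessFamily K n).filter (fun X => ¬ C ⊆ X), 3 / (((4 + X.card).choose 3 : ℕ) : ℚ) := by
  classical
  have hfull : ∑ X ∈ witnessFamily K n, 3 / (((4 + X.card).choose 3 : ℕ) : ℚ) = 3 * U0.z1Sum n := by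
    rw [sum_witnessFamily K n (fun x => 3 / (((4 + x).choose 3 : ℕ) : ℚ)), hK]
    unfold U0.z1Sum
    rw [Finset.mul_sum]
    apply Finset.sum_congr rfl
    intro i _
    rw [show 4 + (i + 1) = i + 5 by omega]
    ring
  have hlost : ∑ X ∈ (witnessFamily K n).filter (fun X => C ⊆ X), 3 / (((4 + X.card).choose 3 : ℕ) : ℚ) =
      3 * U0.lost4Sum n := by
    rw [sum_filter_subset_witnessFamily (by omega) hK hC hCc (fun x => 3 / (((4 + x).choose 3 : ℕ) : ℚ))]
    unfold U0.lost4Sum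
    rw [Finset.mul_sum]
    apply Finset.sum_congr rfl
    intro j _
    rw [show 4 + (j + 3) = j + 7 by omega]
    ring
  have hsplit := Finset.sum_filter_add_sum_filter_not (witnessFamily K n) (fun X => C ⊆ X)
    (fun X => 3 / (((4 + X.card).choose 3 : ℕ) : ℚ))
  have hkey := U0.zero_l3four n hn
  have hphi : phiK (n + 4) 3 = ∑ i ∈ range n, ((n + 4).choose (i + 1) : ℚ) / ((i + 4).choose 3 : ℚ) := by
    unfold phiK
    rw [phiW_eq_phiK_form n]
    rfl
  rw [← hphi] at hkey
  linarith

/-- The good witnesses of a `5`-set `B′ ⊇ ℓ` pay at least `Φ(p, 3)`: `Σ_{C ⊄ X} 8 / C(5 + |X|, 3) ≥ Φ`. -/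
theorem sum_good_five_ge {K C : Finset α} {n : ℕ} (hn : 4 ≤ n) (hK : K.card = n + 4) (hC : C ⊆ K)
    (hCc : C.card = 3) :
    phiK (n + 4) 3 ≤ ∑ X ∈ (witnessFamily K n).filter (fun X => ¬ C ⊆ X), 8 / (((5 + X.card).choose 3 : ℕ) : ℚ) := by
  classical
  have hfull : ∑ X ∈ witnessFamily K n, 8 / (((5 + X.card).choose 3 : ℕ) : ℚ) = 8 * U0.z2Sum n := by
    rw [sum_witnessFamily K n (fun x => 8 / (((5 + x).choose 3 : ℕ) : ℚ)), hK]
    unfold U0.z2Sum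
    rw [Finset.mul_sum]
    apply Finset.sum_congr rfl
    intro i _
    rw [show 5 + (i + 1) = i + 6 by omega]
    ring
  have hlost : ∑ X ∈ (witnessFamily K n).filter (fun X => C ⊆ X), 8 / (((5 + X.card).choose 3 : ℕ) : ℚ) =
      8 * U0.lost5Sum n := by
    rw [sum_filter_subset_witnessFamily (by omega) hK hC hCc (fun x => 8 / (((5 + x).choose 3 : ℕ) : ℚ))]
    unfold U0.lost5Sum
    rw [Finset.mul_sum]
    apply Finset.sum_congr rfl
    intro j _
    rw [show 5 + (j + 3) = j + 8 by omega]
    ring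
  have hsplit := Finset.sum_filter_add_sum_filter_not (witnessFamily K n) (fun X => C ⊆ X)
    (fun X => 8 / (((5 + X.card).choose 3 : ℕ) : ℚ))
  have hkey := U0.zero_l3five n hn
  have hphi : phiK (n + 4) 3 = ∑ i ∈ range n, ((n + 4).choose (i + 1) : ℚ) / ((i + 4).choose 3 : ℚ) := by
    unfold phiK
    rw [phiW_eq_phiK_form n]
    rfl
  rw [← hphi] at hkey
  linarith

/-- The `x`-subsets of `K` with at most one point of `C` number at least `C(|K| − 3, x) + 3 C(|K| − 3, x − 1)`
(`1 ≤ x`, `|C| = 3`): the subsets of `K ∖ C` and the subsets `{c} ∪ Y`, `c ∈ C`, `Y ⊆ K ∖ C`. -/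
theorem card_powersetCard_not_subset_ge {K C : Finset α} (hC : C ⊆ K) (hCc : C.card = 3) {x : ℕ} (hx : 1 ≤ x) :
    (K.card - 3).choose x + 3 * (K.card - 3).choose (x - 1) ≤
      ((K.powersetCard x).filter (fun X => ¬ C ⊆ X)).card := by
  classical
  set D := K \ C with hD
  have hDc : D.card = K.card - 3 := by rw [hD, Finset.card_sdiff_of_subset hC, hCc]
  have hDC : Disjoint D C := Finset.sdiff_disjoint
  -- the two families
  set F0 : Finset (Finset α) := D.powersetCard x with hF0
  set F1 : Finset (Finset α) := C.biUnion (fun c => (D.powersetCard (x - 1)).image (fun Y => insert c Y)) with hF1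
  have hF0sub : F0 ⊆ (K.powersetCard x).filter (fun X => ¬ C ⊆ X) := by
    intro X hX
    rw [hF0, Finset.mem_powersetCard] at hX
    rw [Finset.mem_filter, Finset.mem_powersetCard]
    refine ⟨⟨hX.1.trans Finset.sdiff_subset, hX.2⟩, ?_⟩
    intro hCX
    obtain ⟨c, hc⟩ := Finset.card_pos.1 (show 0 < C.card by omega)
    have := hX.1 (hCX hc)
    rw [hD, Finset.mem_sdiff] at this
    exact this.2 hc
  have hF1sub : F1 ⊆ (K.powersetCard x).filter (fun X => ¬ C ⊆ X) := by
    intro X hX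
    rw [hF1, Finset.mem_biUnion] at hX
    obtain ⟨c, hc, hX⟩ := hX
    rw [Finset.mem_image] at hX
    obtain ⟨Y, hY, rfl⟩ := hX
    rw [Finset.mem_powersetCard] at hY
    have hcY : c ∉ Y := fun h => Finset.disjoint_left.1 hDC (hY.1 h) hc
    rw [Finset.mem_filter, Finset.mem_powersetCard]
    refine ⟨⟨Finset.insert_subset (hC hc) (hY.1.trans Finset.sdiff_subset), ?_⟩, ?_⟩
    · rw [Finset.card_insert_of_notMem hcY, hY.2]
      omega
    · intro hCX
      -- `C` has a point `c' ≠ c`, which would lie in `Y ⊆ D`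
      obtain ⟨c', hc', hcc'⟩ : ∃ c' ∈ C, c' ≠ c := by
        by_contra hcon
        push Not at hcon
        have : C ⊆ {c} := fun z hz => Finset.mem_singleton.2 (hcon z hz)
        have := Finset.card_le_card this
        rw [Finset.card_singleton] at this
        omega
      have := hCX hc'
      rw [Finset.mem_insert] at this
      rcases this with h | h
      · exact hcc' h
      · exact Finset.disjoint_left.1 hDC (hY.1 h) hc'
  have hdisj : Disjoint F0 F1 := by
    rw [Finset.disjoint_left]
    intro X hX0 hX1
    rw [hF0, Finset.mem_powersetCard] at hX0
    rw [hF1, Finset.mem_biUnion] at hX1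
    obtain ⟨c, hc, hX1⟩ := hX1
    rw [Finset.mem_image] at hX1
    obtain ⟨Y, _, rfl⟩ := hX1
    have := hX0.1 (Finset.mem_insert_self c Y)
    exact Finset.disjoint_left.1 hDC this hc
  have hF0c : F0.card = (K.card - 3).choose x := by
    rw [hF0, Finset.card_powersetCard, hDc]
  have hF1c : F1.card = 3 * (K.card - 3).choose (x - 1) := by
    rw [hF1, Finset.card_biUnion]
    · rw [Finset.sum_congr rfl (fun c hc => by
        rw [Finset.card_image_of_injOn (fun Y hY Y' hY' h => by
          rw [Finset.mem_coe, Finset.mem_powersetCard] at hY hY'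
          have hcY : c ∉ Y := fun h' => Finset.disjoint_left.1 hDC (hY.1 h') hc
          have hcY' : c ∉ Y' := fun h' => Finset.disjoint_left.1 hDC (hY'.1 h') hc
          have h' : insert c Y = insert c Y' := h
          rw [← Finset.erase_insert hcY, ← Finset.erase_insert hcY', h']), Finset.card_powersetCard, hDc]),
        Finset.sum_const, hCc, smul_eq_mul]
    · intro c _ c' _ hne
      rw [Function.onFun, Finset.disjoint_left]
      intro X hX hX'
      rw [Finset.mem_image] at hX hX'
      obtain ⟨Y, hY, rfl⟩ := hX
      obtain ⟨Y', hY', hYY'⟩ := hX'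
      rw [Finset.mem_powersetCard] at hY hY'
      -- `c ∈ insert c' Y'` forces `c = c'` or `c ∈ Y' ⊆ D`
      have : c ∈ insert c' Y' := by rw [hYY']; exact Finset.mem_insert_self c Y
      rw [Finset.mem_insert] at this
      rcases this with h | h
      · exact hne h
      · exact Finset.disjoint_left.1 hDC (hY'.1 h) ‹c ∈ C›
  calc (K.card - 3).choose x + 3 * (K.card - 3).choose (x - 1) = F0.card + F1.card := by rw [hF0c, hF1c]
    _ = (F0 ∪ F1).card := (Finset.card_union_of_disjoint hdisj).symm
    _ ≤ ((K.powersetCard x).filter (fun X => ¬ C ⊆ X)).card :=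
        Finset.card_le_card (Finset.union_subset hF0sub hF1sub)

/-- The good witnesses of a `≥ 6`-set `B′ ⊇ ℓ` (share `1` each) pay at least `Φ(p, 3)`:
`#{X ∈ W : C ⊄ X} ≥ l2aSum n ≥ Φ`. -/
theorem card_not_subset_ge {K C : Finset α} {n : ℕ} (hn : 4 ≤ n) (hK : K.card = n + 4) (hC : C ⊆ K)
    (hCc : C.card = 3) :
    phiK (n + 4) 3 ≤ (((witnessFamily K n).filter (fun X => ¬ C ⊆ X)).card : ℚ) := by
  classical
  have hkey := U0.zero_l2a n hn
  have hphi : phiK (n + 4) 3 = ∑ i ∈ range n, ((n + 4).choose (i + 1) : ℚ) / ((i + 4).choose 3 : ℚ) := by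
    unfold phiK
    rw [phiW_eq_phiK_form n]
    rfl
  rw [← hphi] at hkey
  refine hkey.trans ?_
  unfold U0.l2aSum
  unfold witnessFamily
  rw [Finset.filter_biUnion, Finset.card_biUnion (fun x _ y _ h => by
    exact Finset.disjoint_filter_filter (K.pairwise_disjoint_powersetCard h))]
  rw [Nat.cast_sum, Finset.sum_Ico_eq_sum_range, show n + 1 - 1 = n from rfl]
  apply Finset.sum_le_sum
  intro i _
  have h := card_powersetCard_not_subset_ge hC hCc (x := 1 + i) (by omega)
  rw [hK, show n + 4 - 3 = n + 1 by omega, show 1 + i - 1 = i by omega] at h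
  rw [add_comm 1 i] at h ⊢
  exact_mod_cast h

end NightThree

end PercRepro
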